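import Literature.Probability.Percolation.QuadCrossingDiscreteGluing
import Literature.Probability.Percolation.BlockResamplingL2
import Literature.Probability.Percolation.ZdFourArmAPrioriLowerBound
import Literature.Probability.Percolation.FourArmGarbanHolds
import HarnessLib

/-!
# The discrete gluing theorem for bond `ℤ²`, unconditionally, and its `L²` form

Topic `Literature/Probability/Percolation`; proofs only.  `QuadCrossingDiscreteGluing.lean` proves
Schramm–Smirnov's Theorem 1.1 (*On the scaling limits of planar percolation*, Ann. Probab. 39 (2011),
§2) for critical bond percolation on `δℤ²` from a multi-scale four-arm bound
`π₄(m,n) ≤ c (m/n)^{1+ε}` (hypothesis `hfour`).  Here that hypothesis is discharged: it is the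
tree's named fact `Garban2011_fourArm_multiscale` (C. Garban, Appendix B of the source; van den
Berg–Nolin 2020, Lemma 8), PROVED in the tree (`Garban2011_fourArm_multiscale_holds`,
`FourArmGarbanHolds.lean`), whose RSW two-arm hypothesis follows from the tree's one-arm bound
`real_sqAnnulusOpenCrossing_le_rpow_of_le_half` (`π₂ ≤ π₁ ≤ C (m/n)^a`):

* `exists_fourArm_bound` — `Garban2011_fourArm_multiscale → ∃ c ε > 0, π₄(m,n) ≤ c (m/n)^{1+ε}`,
  and `fourArm_bound` — the same unconditionally;
* `discreteGluing_of_finite_inter` — **Theorem 1.1 for bond `ℤ²`, unconditional** (proviso: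
  `α ∩ ∂[Q]` finite, the general-position assumption arranged first in print);
* `discreteGluing_sq_of_finite_inter` — its `L²` form, as used in the proof of Prop. 4.1 ((4.2) and
  "Final estimates": "`‖Y₀ - Y_s‖₂² < 2ε₀ + ε₀² < 3ε₀`"), through
  `integral_sq_indicator_sub_blockCondProb_le` (`BlockResamplingL2.lean`).

## References

* O. Schramm, S. Smirnov (appendix by C. Garban), Ann. Probab. 39 (2011) 1768–1814,
  arXiv:1101.5820, Thm. 1.1, §2, §4 and Appendix B. [SchrammSmirnov2011]
* J. van den Berg, P. Nolin, Progr. Probab. 77 (2020), Lemma 8. [VandenbergNolin2020]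
-/

noncomputable section

open Set Metric MeasureTheory
open Literature.Probability.LatticeModels

namespace Literature.Probability.Percolation

namespace QuadCrossing

/-- **Garban's multi-scale four-arm bound with the RSW two-arm input discharged**: from the named
fact `Garban2011_fourArm_multiscale` (hypothesis) and the tree's one-arm bound
`real_sqAnnulusOpenCrossing_le_rpow_of_le_half` (`π₂ ≤ π₁ ≤ C (m/n)^a`), there are `c, ε > 0` with
`π₄(m,n) ≤ c (m/n)^{1+ε}` for all `1 ≤ m ≤ n`. [cite: SchrammSmirnov2011, Appendix B (Garban), Lemma B.1] -/
theorem exists_fourArm_bound (hG : Garban2011_fourArm_multiscale) :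
    ∃ c ε : ℝ, 0 < c ∧ 0 < ε ∧ ∀ m n : ℕ, 1 ≤ m → m ≤ n →
      (bondPercolation (zdGraph 2) half).real (fourArmTwoClusters m n) ≤ c * ((m : ℝ) / n) ^ (1 + ε) := by
  obtain ⟨C, a, hC, ha, h1⟩ := real_sqAnnulusOpenCrossing_le_rpow_of_le_half
  have hhalf : ((half : unitInterval) : ℝ) ≤ 1 / 2 := by rw [coe_half]
  have htwo : ∃ c' : ℝ, 0 < c' ∧ ∀ m n : ℕ, 1 ≤ m → m ≤ n →
      (bondPercolation (zdGraph 2) half).real (twoArmOpenDual m n) ≤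
        c' * ((m : ℝ) / n) ^ (2 * (a / 2)) := by
    refine ⟨max C 1, lt_max_of_lt_right one_pos, fun m n hm hmn => ?_⟩
    rw [show 2 * (a / 2) = a by ring]
    rcases Nat.eq_or_lt_of_le hmn with rfl | hlt
    · have hn : (m : ℝ) / m = 1 := div_self (by exact_mod_cast (by omega : m ≠ 0))
      rw [hn, Real.one_rpow, mul_one]
      exact measureReal_le_one.trans (le_max_right _ _)
    · calc (bondPercolation (zdGraph 2) half).real (twoArmOpenDual m n)
          ≤ (bondPercolation (zdGraph 2) half).real (sqAnnulusOpenCrossing m n) :=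
            measureReal_mono (twoArmOpenDual_subset_openCrossing m n) (measure_ne_top _ _)
        _ ≤ C * ((m : ℝ) / n) ^ a := h1 half hhalf m n hm hlt
        _ ≤ max C 1 * ((m : ℝ) / n) ^ a :=
            mul_le_mul_of_nonneg_right (le_max_left _ _) (Real.rpow_nonneg (by positivity) _)
  obtain ⟨c, hc, h4⟩ := hG (a / 2) (half_pos ha) htwo
  exact ⟨c, a / 2, hc, half_pos ha, h4⟩

/-- **The multi-scale four-arm bound for critical bond percolation on `ℤ²`, unconditionally**:
`∃ c ε > 0, π₄(m,n) ≤ c (m/n)^{1+ε}` for all `1 ≤ m ≤ n` — Garban's Appendix B as proved in the tree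
(`Garban2011_fourArm_multiscale_holds`) with its RSW input discharged.
[cite: SchrammSmirnov2011, Appendix B, Lemma B.1] -/
theorem fourArm_bound :
    ∃ c ε : ℝ, 0 < c ∧ 0 < ε ∧ ∀ m n : ℕ, 1 ≤ m → m ≤ n →
      (bondPercolation (zdGraph 2) half).real (fourArmTwoClusters m n) ≤ c * ((m : ℝ) / n) ^ (1 + ε) :=
  exists_fourArm_bound Garban2011_fourArm_multiscale_holds

/-- **Schramm–Smirnov's Theorem 1.1 (discrete gluing) for critical bond percolation on `ℤ²`**, for
quads in general position with respect to the cut (`α ∩ ∂[Q]` finite — "approximating if necessary,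
we can assume that `α` intersects `∂Q₀` at finitely many points"): for every `ε ∈ (0,1)` and
`ε₀ > 0`, for all small `s` and then all small meshes `δ`,
`P(ε < P(⊞_Q | ω off the s-neighbourhood of α) < 1 - ε) ≤ ε₀`.  Unconditional:
`discreteGluing_of_fourArm_bound` with `fourArm_bound`. [cite: SchrammSmirnov2011, Thm. 1.1] -/
theorem discreteGluing_of_finite_inter {D : Set ℂ}
    (Q : Quad D) {α : Set ℂ} (hα : IsFiniteLengthPathUnion α)
    (hfin : (α ∩ frontier Q.carrier).Finite) {ε : ℝ} (hε : 0 < ε) (hε1 : ε < 1) {ε₀ : ℝ}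
    (hε₀ : 0 < ε₀) :
    ∃ s₀ : ℝ, 0 < s₀ ∧ ∀ s : ℝ, 0 < s → s < s₀ → ∃ δ₀ : ℝ, 0 < δ₀ ∧ ∀ δ : ℝ, 0 < δ → δ < δ₀ →
      ∀ B : Finset (Sym2 (Site 2)),
        (↑B = {e : Sym2 (Site 2) | ∃ x y : Site 2, (zdGraph 2).Adj x y ∧
          (segment ℝ (meshPoint δ x) (meshPoint δ y) ∩ thickening s α).Nonempty ∧ e = s(x, y)}) →
        (bondPercolation (zdGraph 2) half).real
          {ω | ε < blockCondProb (zdGraph 2) half B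
              (z2QuadConfig D δ ⁻¹' QuadConfig.crossedEvent Q) ω ∧
            blockCondProb (zdGraph 2) half B
              (z2QuadConfig D δ ⁻¹' QuadConfig.crossedEvent Q) ω < 1 - ε} ≤ ε₀ :=
  discreteGluing_of_fourArm_bound fourArm_bound Q hα hfin hε hε1 hε₀

/-- **Discrete gluing, `L²` form** ("`‖Y₀ - Y_s‖₂² < 2ε₀ + ε₀² < 3ε₀`"): for critical bond percolation
on `δℤ²`, a quad `Q` and a cut `α` with `α ∩ ∂[Q]` finite, for every
`ε₀ ∈ (0, 1)`: for all small `s` and then all small meshes `δ`,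
`∫ (𝟙_{⊞_Q} - P(⊞_Q | ω off B_s))² dP ≤ (5/4) ε₀`, `B_s` the lattice edges meeting the
`s`-neighbourhood of `α`. [cite: SchrammSmirnov2011, Thm. 1.1 and proof of Prop. 4.1 ((4.2), "Final estimates")] -/
theorem discreteGluing_sq_of_finite_inter {D : Set ℂ}
    (Q : Quad D) {α : Set ℂ} (hα : IsFiniteLengthPathUnion α)
    (hfin : (α ∩ frontier Q.carrier).Finite) {ε₀ : ℝ} (hε₀ : 0 < ε₀) (hε₀1 : ε₀ < 1) :
    ∃ s₀ : ℝ, 0 < s₀ ∧ ∀ s : ℝ, 0 < s → s < s₀ → ∃ δ₀ : ℝ, 0 < δ₀ ∧ ∀ δ : ℝ, 0 < δ → δ < δ₀ →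
      ∀ B : Finset (Sym2 (Site 2)),
        (↑B = {e : Sym2 (Site 2) | ∃ x y : Site 2, (zdGraph 2).Adj x y ∧
          (segment ℝ (meshPoint δ x) (meshPoint δ y) ∩ thickening s α).Nonempty ∧ e = s(x, y)}) →
        ∫ ω, ((z2QuadConfig D δ ⁻¹' QuadConfig.crossedEvent Q).indicator (1 : BondConfig (Site 2) → ℝ) ω -
            blockCondProb (zdGraph 2) half B (z2QuadConfig D δ ⁻¹' QuadConfig.crossedEvent Q) ω) ^ 2
          ∂(bondPercolation (zdGraph 2) half) ≤ 5 / 4 * ε₀ := by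
  obtain ⟨s₀, hs₀, h⟩ := discreteGluing_of_finite_inter Q hα hfin hε₀ hε₀1 hε₀
  refine ⟨s₀, hs₀, fun s hs hss₀ => ?_⟩
  obtain ⟨δ₀, hδ₀, h'⟩ := h s hs hss₀
  refine ⟨δ₀, hδ₀, fun δ hδ hδδ₀ B hB => ?_⟩
  have hE : MeasurableSet (z2QuadConfig D δ ⁻¹' QuadConfig.crossedEvent Q) :=
    measurableSet_preimage_crossedEvent hδ Q
  have h1 := integral_sq_indicator_sub_blockCondProb_le (zdGraph 2) half B hE hε₀.le
  have h2 := h' δ hδ hδδ₀ B hB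
  linarith

end QuadCrossing

end Literature.Probability.Percolation

end
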